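import Summits.ABC.ABC.Theorems.IneffectiveSubspaceDeepRegimeABCRidoutCoreBound
import Summits.ABC.ABC.Theorems.IneffectiveSubspaceUniformSadicTowerFourOnePrimeOfLevelOne

/-!
# `UniformSadicTowerFour` (stmt-ABC-14937), line `flat-steep-split` (lead c5): the level-one rung
# PER FIXED SET OF PLACES (Ridout's theorem in abc form) and UPD(1,2) PER FIXED PRIME TRIPLE —
# both UNCONDITIONAL

The crux `UniformSadicTowerFour` asks for the LEVEL-ONE RUNG with a constant depending only on the
NUMBER of places: for every `ε > 0` and `K` some `C = C(K, ε)` with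
`c < C · ((∏_{p ∈ S} p) · {abc}^S)^(1+ε)` for every abc triple `(a, b, c)` and every set `S` of at
most `K` primes, where `{m}^S := ∏_{ℓ ∣ m, ℓ ∉ S} ℓ^{v_ℓ(m)}` is the `S`-free part of `m`.  Its
PROVED baseline is the same bound for each FIXED finite set `S` of primes, with `C = C(S, ε)` —
Vojta's reading `{abc}^S ≥ c^(1−ε)/C(S,ε)` of RIDOUT's theorem.  This file derives it, and its
one-prime / two-base reading, UNCONDITIONALLY from the tree's `DeepRegimeABC.ridoutCoreBound_holds`
(Ridout's theorem at the places `{p ≤ y} ∪ {∞}` in abc form, itself proved from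
`Ridout.padicRoth_int` / `Ridout.finite_of_abs_le_one_of_class`, i.e. from the tree's Roth theorem;
ineffective):

* `levelOneRung_fixedPlaces` — for every finite set `S` of primes and `ε > 0` there is `C` with
  `c < C · ((∏_{p ∈ S} p) · {abc}^S)^(1+ε)` for every abc triple `(a, b, c)`;
* `onePrimeTwoBase_fixedPrimes` — UPD(1,2) per FIXED distinct primes `p, q, r`: for every `ε > 0`
  there is `C = C(p, q, r, ε)` such that for all `Y, Z, t ∈ ℕ`, if `p^t ∣ q^Y r^Z − 1` (and
  `q^Y r^Z ≥ 2`) or `p^t ∣ r^Z − q^Y` (and `q^Y < r^Z`), then `p^t ≤ C · (pqr)^(1+ε) · (q^Y r^Z)^ε`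
  (so far in the tree only conditionally on Yu's `p`-adic Baker bound).

**Proof of the rung.** Fix `S`, `ε`; put `δ := ε/(1+ε)` (so `(1−δ)(1+ε) = 1`) and `y := max S`, and
let `B = B(y, δ)` be the bound of `ridoutCoreBound_holds`.  For an abc triple write `N = abc`,
`F = {N}^S` and `G = ∏_{p ∣ N, p ∈ S} p^{v_p(N)}`, so `G · F = N` (unique factorisation) and
`log G ≤ Σ_{p ∣ N, p ≤ y} v_p(N) log p` (`S ⊆ {p ≤ y}`, all terms `≥ 0`).  If `c > B` the Ridout
hypothesis fails: `Σ_{p ≤ y} v_p(N) log p + log(c / min(a,b)) < (2+δ) log c`; with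
`log N = log a + log b + log c = log G + log F` and `log a + log b = log min(a,b) + log max(a,b)`
this gives `log max(a,b) < δ log c + log F`, and `c ≤ 2 max(a,b)` gives `c^(1−δ) < 2F`.  Hence
always `c ≤ B` or `c = (c^(1−δ))^(1+ε) < (2F)^(1+ε)`, and both are `< C · ((∏_{p∈S} p) · F)^(1+ε)`
for `C := (max(B,1) + 1) · 2^(1+ε)` (the bracket is `≥ F ≥ 1`).  **Proof of UPD(1,2) per triple.**
Read the rung at `S = {p, q, r}` on the abc triples `(1, q^Y r^Z − 1, q^Y r^Z)` resp.
`(q^Y, r^Z − q^Y, r^Z)` exactly as in `onePrimeTwoBase_of_levelOneRung` (`onePrime_bracket_mul_le`,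
`onePrime_real`).

Sources: Vojta's level-one abc reading of Ridout's theorem [cite: Vojta1987, Thm. 2.1.1 and §3.2];
Ridout's theorem [cite: Ridout1958] in the form [cite: BombieriGubler2006, Thm. 6.2.3], entering
only through the landed `DeepRegimeABC.ridoutCoreBound_holds`; the rest is elementary unique
factorisation and real bookkeeping [folklore].  Mathlib only (`Finset.prod_inter_mul_prod_sdiff`,
`Nat.prod_factorization_pow_eq_self`, `Real.log_prod`, `Finset.sum_le_sum_of_subset_of_nonneg`,
`min_mul_max`, `Real.rpow_def_of_pos`, `Real.rpow_mul`, `Real.mul_rpow`) plus the landed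
`onePrime_sfree_coprime`, `onePrime_bracket_mul_le`, `onePrime_real`.  No new definitions.
Deliberately NOT here: the crux (uniformity in `S`, OPEN) and UPD(1,2) with `C` independent of the
primes (OPEN, abc-type).
-/

noncomputable section

-- `Summit.<Summit>.<Problem>` is the mandated summit-side namespace (CONVENTIONS §2); for the
-- single-conjunct summit `ABC` the two coincide, so the duplicate `ABC.ABC` is deliberate.
set_option linter.dupNamespace false

namespace Summit.ABC.ABC.Theorems.UniformSadicTowerFour.BoundedOmega

open Literature.NumberTheory.DiophantineGeometry (IsABCTriple rad rad_def)
open Summit.ABC.ABC.Theorems.DeepRegimeABC (ridoutCoreBound_holds)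
open scoped BigOperators

/-! ## The factor split `G · F = N` and the logarithm of the `S`-part -/

/-- **Unique factorisation, split along `S`:** for `N ≠ 0`,
`(∏_{p ∣ N, p ∈ S} p^{v_p(N)}) · (∏_{p ∣ N, p ∉ S} p^{v_p(N)}) = ∏_{p ∣ N} p^{v_p(N)} = N`.
[folklore] -/
private theorem lofp_split {N : ℕ} (hN : N ≠ 0) (S : Finset ℕ) :
    (∏ p ∈ N.primeFactors ∩ S, p ^ N.factorization p) *
        (∏ p ∈ N.primeFactors \ S, p ^ N.factorization p) = N := by
  rw [Finset.prod_inter_mul_prod_sdiff]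
  conv_rhs => rw [← Nat.prod_factorization_pow_eq_self hN,
    Nat.prod_factorization_eq_prod_primeFactors]

/-- **Logarithm of a product of prime powers:** for a finite set `s` of primes,
`log ∏_{p ∈ s} p^{k_p} = Σ_{p ∈ s} k_p log p`. [folklore] -/
private theorem lofp_log_prod_pow (s : Finset ℕ) (hs : ∀ p ∈ s, p.Prime) (k : ℕ → ℕ) :
    Real.log ((∏ p ∈ s, p ^ k p : ℕ) : ℝ) = ∑ p ∈ s, (k p : ℝ) * Real.log p := by
  have hf : ∀ p ∈ s, ((p ^ k p : ℕ) : ℝ) ≠ 0 := fun p hp => by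
    exact_mod_cast (pow_pos (hs p hp).pos (k p)).ne'
  rw [Nat.cast_prod, Real.log_prod hf]
  exact Finset.sum_congr rfl fun p _ => by rw [Nat.cast_pow, Real.log_pow]

/-- **The `S`-part is controlled by the Ridout core mass:** if every `p ∈ S` is `≤ y`, then
`log ∏_{p ∣ N, p ∈ S} p^{v_p(N)} = Σ_{p ∣ N, p ∈ S} v_p(N) log p ≤ Σ_{p ∣ N, p ≤ y} v_p(N) log p`
(a sub-sum of non-negative terms). [folklore] -/
private theorem lofp_logG_le {S : Finset ℕ} {y : ℕ} (hSy : ∀ p ∈ S, p ≤ y) (N : ℕ) :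
    Real.log ((∏ p ∈ N.primeFactors ∩ S, p ^ N.factorization p : ℕ) : ℝ) ≤
      ∑ p ∈ N.primeFactors.filter (fun p => p ≤ y), (N.factorization p : ℝ) * Real.log p := by
  rw [lofp_log_prod_pow _ (fun p hp => Nat.prime_of_mem_primeFactors (Finset.mem_inter.1 hp).1)]
  refine Finset.sum_le_sum_of_subset_of_nonneg (fun p hp => ?_) (fun p _ _ => ?_)
  · obtain ⟨hpN, hpS⟩ := Finset.mem_inter.1 hp
    exact Finset.mem_filter.2 ⟨hpN, hSy p hpS⟩
  · exact mul_nonneg (Nat.cast_nonneg _) (Real.log_natCast_nonneg p)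

/-! ## The real bookkeeping -/

/-- **Failure of the Ridout hypothesis forces a large `S`-free part.** Let `a, b ≥ 1`, `a + b = c`,
`G · F = abc` with `log G ≤ R`, and suppose `R + log (c / min(a,b)) < (2+δ) log c`.  Then, since
`log a + log b + log c = log G + log F`, `log a + log b = log min(a,b) + log max(a,b)` and
`c ≤ 2 max(a,b)`:  `(1−δ) log c < log 2 + log F`, i.e. `c^(1−δ) < 2F`. [folklore] -/
private theorem lofp_claim {a b c G F : ℕ} {R δ : ℝ} (ha : 0 < a) (hb : 0 < b) (hsum : a + b = c)
    (hGF : G * F = a * b * c) (hlogG : Real.log G ≤ R)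
    (hfail : R + Real.log ((c : ℝ) / ((min a b : ℕ) : ℝ)) < (2 + δ) * Real.log c) :
    (c : ℝ) ^ (1 - δ) < 2 * (F : ℝ) := by
  have hc : 0 < c := by omega
  have hN : a * b * c ≠ 0 := by positivity
  have hG : 0 < G := Nat.pos_of_ne_zero fun h => hN (by rw [← hGF, h, zero_mul])
  have hF : 0 < F := Nat.pos_of_ne_zero fun h => hN (by rw [← hGF, h, mul_zero])
  have haR : (0 : ℝ) < a := by exact_mod_cast ha
  have hbR : (0 : ℝ) < b := by exact_mod_cast hb
  have hcR : (0 : ℝ) < c := by exact_mod_cast hc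
  have hGR : (0 : ℝ) < G := by exact_mod_cast hG
  have hFR : (0 : ℝ) < F := by exact_mod_cast hF
  have hm : 0 < min a b := lt_min ha hb
  have hM : 0 < max a b := lt_max_of_lt_left ha
  have hmR : (0 : ℝ) < ((min a b : ℕ) : ℝ) := by exact_mod_cast hm
  have hMR : (0 : ℝ) < ((max a b : ℕ) : ℝ) := by exact_mod_cast hM
  -- `log N` two ways
  have hlogN : Real.log a + Real.log b + Real.log c = Real.log G + Real.log F := by
    rw [← Real.log_mul haR.ne' hbR.ne', ← Real.log_mul (mul_pos haR hbR).ne' hcR.ne',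
      ← Real.log_mul hGR.ne' hFR.ne']
    congr 1
    exact_mod_cast hGF.symm
  -- `{a, b} = {min, max}`
  have hlogmM : Real.log ((min a b : ℕ) : ℝ) + Real.log ((max a b : ℕ) : ℝ) =
      Real.log a + Real.log b := by
    rw [← Real.log_mul hmR.ne' hMR.ne', ← Real.log_mul haR.ne' hbR.ne']
    congr 1
    exact_mod_cast min_mul_max a b
  -- `c ≤ 2 max(a, b)`
  have hc2M : c ≤ 2 * max a b := by
    have := le_max_left a b
    have := le_max_right a b
    omega
  have hlogc : Real.log c ≤ Real.log 2 + Real.log ((max a b : ℕ) : ℝ) := by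
    rw [← Real.log_mul two_ne_zero hMR.ne']
    exact Real.log_le_log hcR (by exact_mod_cast hc2M)
  rw [Real.log_div hcR.ne' hmR.ne'] at hfail
  have hkey : Real.log c * (1 - δ) < Real.log 2 + Real.log F := by linarith
  rw [Real.rpow_def_of_pos hcR, ← Real.exp_log (by positivity : (0 : ℝ) < 2 * F), Real.exp_lt_exp,
    Real.log_mul two_ne_zero hFR.ne']
  exact hkey

/-- **Assembly of the constant.** With `(1−δ)(1+ε) = 1`, `PS, F ≥ 1` and either `c ≤ B` or
`c^(1−δ) < 2F`:  `c < (max(B,1) + 1) · 2^(1+ε) · (PS · F)^(1+ε)` — in the first case because the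
last two factors are `≥ 1`, in the second because `c = (c^(1−δ))^(1+ε) < 2^(1+ε) F^(1+ε)`.
[folklore] -/
private theorem lofp_assemble {B ε δ : ℝ} {c F PS : ℕ} (hε : 0 < ε) (hexp : (1 - δ) * (1 + ε) = 1)
    (hPS : 0 < PS) (hF : 0 < F) (halt : (c : ℝ) ≤ B ∨ (c : ℝ) ^ (1 - δ) < 2 * (F : ℝ)) :
    (c : ℝ) < (max B 1 + 1) * 2 ^ (1 + ε) * ((PS * F : ℕ) : ℝ) ^ (1 + ε) := by
  have hε1 : (0 : ℝ) ≤ 1 + ε := by linarith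
  have hbr1 : (1 : ℝ) ≤ ((PS * F : ℕ) : ℝ) := by exact_mod_cast Nat.mul_pos hPS hF
  have hFle : (F : ℝ) ≤ ((PS * F : ℕ) : ℝ) := by exact_mod_cast Nat.le_mul_of_pos_left F hPS
  have h2 : (1 : ℝ) ≤ 2 ^ (1 + ε) := Real.one_le_rpow (by norm_num) hε1
  have hb2 : (1 : ℝ) ≤ ((PS * F : ℕ) : ℝ) ^ (1 + ε) := Real.one_le_rpow hbr1 hε1
  have hK : (1 : ℝ) ≤ max B 1 + 1 := by linarith [le_max_right B 1]
  rcases halt with hcB | hlt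
  · calc (c : ℝ) ≤ B := hcB
      _ < max B 1 + 1 := by linarith [le_max_left B 1]
      _ = (max B 1 + 1) * 1 * 1 := by ring
      _ ≤ (max B 1 + 1) * 2 ^ (1 + ε) * ((PS * F : ℕ) : ℝ) ^ (1 + ε) :=
          mul_le_mul (mul_le_mul_of_nonneg_left h2 (by linarith)) hb2 zero_le_one (by positivity)
  · have hc0 : (0 : ℝ) ≤ c := Nat.cast_nonneg _
    have hF0 : (0 : ℝ) ≤ F := Nat.cast_nonneg _
    calc (c : ℝ) = ((c : ℝ) ^ (1 - δ)) ^ (1 + ε) := by rw [← Real.rpow_mul hc0, hexp, Real.rpow_one]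
      _ < (2 * (F : ℝ)) ^ (1 + ε) := Real.rpow_lt_rpow (Real.rpow_nonneg hc0 _) hlt (by linarith)
      _ = 2 ^ (1 + ε) * (F : ℝ) ^ (1 + ε) := Real.mul_rpow (by norm_num) hF0
      _ ≤ 2 ^ (1 + ε) * ((PS * F : ℕ) : ℝ) ^ (1 + ε) :=
          mul_le_mul_of_nonneg_left (Real.rpow_le_rpow hF0 hFle hε1) (by positivity)
      _ ≤ (max B 1 + 1) * 2 ^ (1 + ε) * ((PS * F : ℕ) : ℝ) ^ (1 + ε) := by
          rw [mul_assoc (max B 1 + 1)]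
          exact le_mul_of_one_le_left (by positivity) hK

/-! ## The theorems -/

/-- **The level-one rung per fixed set of places (Ridout's theorem in abc form), unconditional.**
For every finite set `S` of primes and every `ε > 0` there is `C = C(S, ε) > 0` such that every abc
triple `(a, b, c)` satisfies `c < C · ((∏_{p ∈ S} p) · {abc}^S)^(1+ε)`, where
`{abc}^S = ∏_{ℓ ∣ abc, ℓ ∉ S} ℓ^{v_ℓ(abc)}` is the `S`-free part — Vojta's
`{abc}^S ≥ c^(1−ε')/C`.  From `DeepRegimeABC.ridoutCoreBound_holds` at `y = max S`, `δ = ε/(1+ε)`: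
off the bounded set `c ≤ B` the Ridout core mass is `< (2+δ) log c`, which unwinds to
`c^(1−δ) < 2 {abc}^S` (`lofp_claim`), and `(1−δ)(1+ε) = 1` (`lofp_assemble`).
[cite: Vojta1987, Thm. 2.1.1 and §3.2] -/
theorem levelOneRung_fixedPlaces :
    ∀ S : Finset ℕ, (∀ p ∈ S, Nat.Prime p) → ∀ ε : ℝ, 0 < ε → ∃ C : ℝ, 0 < C ∧
      ∀ a b c : ℕ, IsABCTriple a b c →
        (c : ℝ) < C * ((((∏ p ∈ S, p) *
          ∏ p ∈ (a * b * c).primeFactors \ S, p ^ (a * b * c).factorization p : ℕ) : ℝ)) ^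
            (1 + ε) := by
  intro S hS ε hε
  have h1ε : (1 + ε : ℝ) ≠ 0 := by positivity
  have hδ : 0 < ε / (1 + ε) := by positivity
  have hexp : (1 - ε / (1 + ε)) * (1 + ε) = 1 := by
    rw [sub_mul, one_mul, div_mul_cancel₀ ε h1ε]
    ring
  have hSy : ∀ p ∈ S, p ≤ S.sup id := fun p hp => Finset.le_sup (f := id) hp
  obtain ⟨B, hB⟩ := ridoutCoreBound_holds (S.sup id) (ε / (1 + ε)) hδ
  refine ⟨(max B 1 + 1) * 2 ^ (1 + ε), by positivity, ?_⟩
  intro a b c habc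
  have hPS : 0 < ∏ p ∈ S, p := Finset.prod_pos fun p hp => (hS p hp).pos
  have hF : 0 < ∏ p ∈ (a * b * c).primeFactors \ S, p ^ (a * b * c).factorization p :=
    Finset.prod_pos fun p hp =>
      pow_pos (Nat.prime_of_mem_primeFactors (Finset.mem_sdiff.1 hp).1).pos _
  refine lofp_assemble hε hexp hPS hF ?_
  rcases le_or_gt (c : ℝ) B with hcB | hBc
  · exact Or.inl hcB
  · obtain ⟨ha, hb, hsum, -⟩ := id habc
    have hN : a * b * c ≠ 0 := by
      have : 0 < c := by omega
      positivity
    have hfail := lt_of_not_ge fun h => (not_le.2 hBc) (hB a b c habc h)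
    exact Or.inr (lofp_claim ha hb hsum (lofp_split hN S) (lofp_logG_le hSy _) hfail)

/-- **UPD(1,2) per fixed prime triple, unconditional (ineffective).**  For distinct primes `p, q, r`
and every `ε > 0` there is `C = C(p, q, r, ε) > 0` such that for all `Y, Z, t ∈ ℕ`: if
`p^t ∣ q^Y r^Z − 1` with `q^Y r^Z ≥ 2`, or `p^t ∣ r^Z − q^Y` with `q^Y < r^Z`, then
`p^t ≤ C · (pqr)^(1+ε) · (q^Y r^Z)^ε`.  Read `levelOneRung_fixedPlaces` at `S = {p, q, r}` on the
abc triples `(1, q^Y r^Z − 1, q^Y r^Z)` resp. `(q^Y, r^Z − q^Y, r^Z)`: the `S`-free part of `abc`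
times `p^t` divides `b < c` (`onePrime_bracket_mul_le`, `onePrime_real`), and `c ≤ q^Y r^Z` —
verbatim the argument of `onePrimeTwoBase_of_levelOneRung`. [cite: Vojta1987, §3.2] -/
theorem onePrimeTwoBase_fixedPrimes :
    ∀ p q r : ℕ, p.Prime → q.Prime → r.Prime → p ≠ q → p ≠ r → q ≠ r → ∀ ε : ℝ, 0 < ε →
      ∃ C : ℝ, 0 < C ∧ ∀ Y Z t : ℕ,
      (p ^ t ∣ q ^ Y * r ^ Z - 1 ∧ 2 ≤ q ^ Y * r ^ Z) ∨ (p ^ t ∣ r ^ Z - q ^ Y ∧ q ^ Y < r ^ Z) →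
      ((p ^ t : ℕ) : ℝ) ≤ C * ((p * q * r : ℕ) : ℝ) ^ (1 + ε) * ((q ^ Y * r ^ Z : ℕ) : ℝ) ^ ε := by
  intro p q r hp hq hr hpq hpr hqr ε hε
  have hprime : ∀ x ∈ ({p, q, r} : Finset ℕ), x.Prime := by
    intro x hx
    simp only [Finset.mem_insert, Finset.mem_singleton] at hx
    rcases hx with rfl | rfl | rfl <;> assumption
  obtain ⟨C, hC, hS⟩ := levelOneRung_fixedPlaces {p, q, r} hprime ε hε
  refine ⟨C, hC, ?_⟩
  intro Y Z t hyp
  have hP : 1 ≤ p ^ t := Nat.one_le_pow _ _ hp.pos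
  have hqY : 0 < q ^ Y := pow_pos hq.pos _
  have hrZ : 0 < r ^ Z := pow_pos hr.pos _
  have hqS : q ∈ ({p, q, r} : Finset ℕ) := by simp
  have hrS : r ∈ ({p, q, r} : Finset ℕ) := by simp
  rcases hyp with ⟨hdvd, h2⟩ | ⟨hdvd, hlt⟩
  · -- product case: the abc triple `(1, q^Y r^Z - 1, q^Y r^Z)`
    have habc : IsABCTriple 1 (q ^ Y * r ^ Z - 1) (q ^ Y * r ^ Z) :=
      ⟨one_pos, by omega, by omega, Nat.coprime_one_left _⟩
    have hrung := hS 1 (q ^ Y * r ^ Z - 1) (q ^ Y * r ^ Z) habc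
    have hnat := onePrime_bracket_mul_le habc hp hpq hpr hqr hdvd (Nat.coprime_one_right _)
      (((onePrime_sfree_coprime hq hqS).pow_right Y).mul_right
        ((onePrime_sfree_coprime hr hrS).pow_right Z))
    exact onePrime_real hC hε (by omega) hrung hnat (by omega) hP
  · -- difference case: the abc triple `(q^Y, r^Z - q^Y, r^Z)`
    have hcop : Nat.Coprime (q ^ Y) (r ^ Z - q ^ Y) :=
      (Nat.coprime_sub_self_right hlt.le).2 (Nat.Coprime.pow Y Z ((Nat.coprime_primes hq hr).2 hqr))
    have habc : IsABCTriple (q ^ Y) (r ^ Z - q ^ Y) (r ^ Z) := ⟨hqY, by omega, by omega, hcop⟩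
    have hrung := hS (q ^ Y) (r ^ Z - q ^ Y) (r ^ Z) habc
    have hnat := onePrime_bracket_mul_le habc hp hpq hpr hqr hdvd
      ((onePrime_sfree_coprime hq hqS).pow_right Y) ((onePrime_sfree_coprime hr hrS).pow_right Z)
    have hmain := onePrime_real hC hε hrZ hrung hnat (by omega) hP
    have hcle : ((r ^ Z : ℕ) : ℝ) ≤ ((q ^ Y * r ^ Z : ℕ) : ℝ) := by
      exact_mod_cast Nat.le_mul_of_pos_left (r ^ Z) hqY
    calc ((p ^ t : ℕ) : ℝ) ≤ C * ((p * q * r : ℕ) : ℝ) ^ (1 + ε) * ((r ^ Z : ℕ) : ℝ) ^ ε := hmain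
      _ ≤ C * ((p * q * r : ℕ) : ℝ) ^ (1 + ε) * ((q ^ Y * r ^ Z : ℕ) : ℝ) ^ ε :=
          mul_le_mul_of_nonneg_left (Real.rpow_le_rpow (Nat.cast_nonneg _) hcle hε.le)
            (mul_nonneg hC.le (Real.rpow_nonneg (Nat.cast_nonneg _) _))

end Summit.ABC.ABC.Theorems.UniformSadicTowerFour.BoundedOmega

end
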